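import Summits.QuantumFields.YangMills.Theorems.ComplexCouplingChannelHarmonicMeasureEngineDiscChain
import HarnessLib

/-!
# Crux `IR` (stmt-QuantumFields-19354) — the two CLASSICAL pool targets of the purity-channel lines, PROVED:
# the two-constants theorem `TwoConstants` (T) and the Poisson–Jensen estimate `PoissonJensen` (P)

Helper module for item `stmt-QuantumFields-19354` (`--supports … --as helper`; it closes nothing).  The ideator file
`Cruxes/IR/Lines/purity_channel_classical.lean` (ym-ir-idea-16 g0; critic of record ym-ir-crit-4, 03:56:58Z: «list T as a POOL
formalisation target») isolates the two classical stubs of LINES `harmonic-purity-channel` (`stub_twoConstants : TwoConstants`)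
and `jensen-purity-channel` (`stub_poissonJensen : PoissonJensen`) — pure complex analysis, no lattice objects.  This file proves
both statements VERBATIM (bodies unfolded, no new definitions), so that each of the three skeleton stubs closes by `exact`:

* `twoConstants_holds` — **T**: for an open connected `D ⊆ ℂ`, a closed disc `closedBall z₀ δ₀ ⊆ D` and a target `zT ∈ D` there is
  an exponent `ω ∈ (0,1]`, depending on the geometry only, with `‖F zT‖ ≤ a ^ ω * A ^ (1 - ω)` for every `F` holomorphic on `D`
  bounded by `A` on `D` and by `a ≤ A` on the disc.  It is a COROLLARY of the tree's disc-chain two-constants theorem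
  `ComplexCouplingChannel.exists_exponent_norm_le_rpow_mul_rpow` (`Theorems/ComplexCouplingChannelHarmonicMeasureEngineDiscChain.lean`,
  route `ComplexCouplingChannel`: chain of Hadamard three-circles discs, `ω = 2^{-N}`), applied with `x = z₀`, `r₀ = δ₀`, `β = zT`.
* `poissonJensen_of_twoConstants` — **P from T** by Blaschke factors of the disc `B(zT, R) ⊇ D` and the maximum modulus principle
  (Mathlib `Complex.norm_le_of_forall_mem_frontier_norm_le`), exactly as planned in the ideator file: with
  `Φ := (F / g) · ∏_{ζ∈s} R / (R² − conj(ζ − zT)(· − zT))` one has `Φ · G = F · ∏ b_ζ` (`G = g · ∏ (· − ζ)`,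
  `b_ζ(z) = R(z − ζ)/(R² − conj(ζ − zT)(z − zT))`, `‖b_ζ‖ ≤ 1` on `closedBall zT R ⊇ closure D`), so the contour bound `A` and the
  anchor-circle bound `a` pass to `Φ` on `closure D` and on `closedBall z₀ δ₀`; T bounds `‖Φ zT‖ ≤ a^ω A^{1−ω}`; and at the target
  `∏ R/(R² − 0) = R^{-|s|}` while `exp(greenBudget) · ‖∏ (zT − ζ)‖ = R^{|s|}`, which is P's conclusion with the sharp budget
  `Σ log(R/‖ζ − zT‖)`.  No harmonic measure / subharmonic functions are needed.
* `poissonJensen_holds` — **P**.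

References: R. Nevanlinna, *Eindeutige analytische Funktionen* (1936) §III.2 (two-constants theorem); T. Ransford, *Potential
theory in the complex plane* (1995) Thm 4.3.7; the Poisson–Jensen formula (e.g. Hayman, *Meromorphic functions*, Thm 1.1) — here in
the inequality form with Green potentials majorised by `log(R/‖ζ − zT‖)` (domain monotonicity `D ⊆ B(zT,R)`).

HONEST FRAMING.  These are the classical (M) legs of two ideator lines whose LOADS (`PurityChannel`, `SparseChannel`) are the infrared
wall re-typed (crit-4: width 0); nothing here bears on `BalabanLadder.IR`, confinement, a lattice gap or the Yang–Mills mass gap (Clay),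
which are NOT proved; `R4` closes only the conditional finite-𝕋⁴ rung `BalabanLadder.UV`.
-/

set_option autoImplicit false

noncomputable section

open Complex Metric Set Filter Topology

namespace Summit.QuantumFields.YangMills.Cruxes.IR.PurityChannelClassical

open Summit.QuantumFields.YangMills.Theorems.ComplexCouplingChannel (exists_exponent_norm_le_rpow_mul_rpow)

/-! ## §1 T — the two-constants theorem (verbatim body of `TwoConstants`) -/

/-- **T (`TwoConstants`, verbatim).**  For an open connected `D ⊆ ℂ`, a closed disc `closedBall z₀ δ₀ ⊆ D` (`0 < δ₀`) and a target
`zT ∈ D` there is `ω ∈ (0, 1]` such that every `F` complex differentiable on `D` with `‖F‖ ≤ A` on `D` and `‖F‖ ≤ a` on the disc,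
`0 < a ≤ A`, satisfies `‖F zT‖ ≤ a ^ ω * A ^ (1 - ω)`.  Corollary of the tree's disc-chain theorem
`exists_exponent_norm_le_rpow_mul_rpow` (Nevanlinna's two-constants theorem with the harmonic measure replaced by `2^{-N}`). -/
theorem twoConstants_holds :
    ∀ (D : Set ℂ), IsOpen D → IsConnected D →
      ∀ (z₀ : ℂ) (δ₀ : ℝ), 0 < δ₀ → Metric.closedBall z₀ δ₀ ⊆ D → ∀ zT : ℂ, zT ∈ D →
        ∃ ω : ℝ, 0 < ω ∧ ω ≤ 1 ∧
          ∀ F : ℂ → ℂ, DifferentiableOn ℂ F D →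
            ∀ a A : ℝ, 0 < a → a ≤ A →
              (∀ z ∈ D, ‖F z‖ ≤ A) → (∀ z ∈ Metric.closedBall z₀ δ₀, ‖F z‖ ≤ a) →
                ‖F zT‖ ≤ a ^ ω * A ^ (1 - ω) := by
  intro D hD hDc z₀ δ₀ hδ₀ hdisc zT hzT
  have hz₀ : z₀ ∈ D := hdisc (mem_closedBall_self hδ₀.le)
  obtain ⟨θ, hθ0, hθ1, hθ⟩ := exists_exponent_norm_le_rpow_mul_rpow hD hDc.isPreconnected hz₀ hzT hδ₀
  refine ⟨θ, hθ0, hθ1, fun F hF a A ha haA hA hsmall => hθ F A a hF ha haA hA ?_⟩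
  intro z _ hz
  exact hsmall z (mem_closedBall.2 hz.le)

/-! ## §2 Blaschke factors of the disc `B(zT, R)` -/

/-- The denominator `R² − conj(ζ − zT)(z − zT)` of the Blaschke factor does not vanish for `‖ζ − zT‖ < R`, `‖z − zT‖ ≤ R`:
indeed `‖conj(ζ − zT)(z − zT)‖ < R²`. [folklore] -/
theorem norm_conj_mul_lt_sq (zT : ℂ) {R : ℝ} (hR : 0 < R) {ζ z : ℂ} (hζ : ‖ζ - zT‖ < R) (hz : ‖z - zT‖ ≤ R) :
    ‖(starRingEnd ℂ) (ζ - zT) * (z - zT)‖ < R ^ 2 := by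
  rw [norm_mul, Complex.norm_conj]
  calc ‖ζ - zT‖ * ‖z - zT‖ ≤ ‖ζ - zT‖ * R := mul_le_mul_of_nonneg_left hz (norm_nonneg _)
    _ < R * R := mul_lt_mul_of_pos_right hζ hR
    _ = R ^ 2 := by ring

/-- Non-vanishing of the Blaschke denominator on the closed disc. [folklore] -/
theorem blaschkeDen_ne_zero (zT : ℂ) {R : ℝ} (hR : 0 < R) {ζ z : ℂ} (hζ : ‖ζ - zT‖ < R) (hz : ‖z - zT‖ ≤ R) :
    ((R : ℂ) ^ 2 - (starRingEnd ℂ) (ζ - zT) * (z - zT)) ≠ 0 := by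
  intro h
  have h' : (starRingEnd ℂ) (ζ - zT) * (z - zT) = (R : ℂ) ^ 2 := (sub_eq_zero.mp h).symm
  have : ‖(starRingEnd ℂ) (ζ - zT) * (z - zT)‖ = R ^ 2 := by
    rw [h', norm_pow, Complex.norm_real, Real.norm_eq_abs, abs_of_pos hR]
  linarith [norm_conj_mul_lt_sq zT hR hζ hz]

/-- `‖b_ζ(z)‖ ≤ 1` on the closed disc `‖z − zT‖ ≤ R` when `‖ζ − zT‖ < R`, for the Blaschke factor
`b_ζ(z) = R(z − ζ)/(R² − conj(ζ − zT)(z − zT))`: the inequality `R‖z' − ζ'‖ ≤ |R² − conj(ζ') z'|` is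
`(R² − ‖z'‖²)(R² − ‖ζ'‖²) ≥ 0` (`z' = z − zT`, `ζ' = ζ − zT`). [folklore] -/
theorem norm_blaschkeFactor_le_one (zT : ℂ) {R : ℝ} (hR : 0 < R) {ζ z : ℂ}
    (hζ : ‖ζ - zT‖ < R) (hz : ‖z - zT‖ ≤ R) :
    ‖(R : ℂ) * (z - ζ) / ((R : ℂ) ^ 2 - (starRingEnd ℂ) (ζ - zT) * (z - zT))‖ ≤ 1 := by
  -- adapted from `norm_blaschke_le_one` of `Cruxes/IR/Lines/purity_channel_classical.lean` (ym-ir-idea-16)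
  set ζ' : ℂ := ζ - zT with hζ'
  set z' : ℂ := z - zT with hz'
  have hzz : z - ζ = z' - ζ' := by simp [hζ', hz']
  rw [hzz]
  have hden_ne : ((R : ℂ) ^ 2 - (starRingEnd ℂ) ζ' * z') ≠ 0 := blaschkeDen_ne_zero zT hR hζ hz
  rw [norm_div, div_le_one (norm_pos_iff.mpr hden_ne)]
  have h0 : 0 ≤ ‖(R : ℂ) * (z' - ζ')‖ := norm_nonneg _
  have h1 : 0 ≤ ‖(R : ℂ) ^ 2 - (starRingEnd ℂ) ζ' * z'‖ := norm_nonneg _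
  rw [← abs_of_nonneg h0, ← abs_of_nonneg h1, ← sq_le_sq, Complex.sq_norm, Complex.sq_norm,
    Complex.normSq_apply, Complex.normSq_apply]
  simp only [Complex.mul_re, Complex.mul_im, Complex.sub_re, Complex.sub_im, Complex.ofReal_re, Complex.ofReal_im,
    Complex.conj_re, Complex.conj_im, zero_mul, sub_zero, add_zero]
  have hz2 : z'.re * z'.re + z'.im * z'.im ≤ R ^ 2 := by
    have h : ‖z'‖ ^ 2 ≤ R ^ 2 := by nlinarith [norm_nonneg z', hz]
    rw [Complex.sq_norm, Complex.normSq_apply] at h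
    exact h
  have hζ2 : ζ'.re * ζ'.re + ζ'.im * ζ'.im ≤ R ^ 2 := by
    have h : ‖ζ'‖ ^ 2 ≤ R ^ 2 := by nlinarith [norm_nonneg ζ', hζ.le]
    rw [Complex.sq_norm, Complex.normSq_apply] at h
    exact h
  have hRR : ((R : ℂ) ^ 2).re = R ^ 2 := by simp [sq, Complex.mul_re]
  have hRI : ((R : ℂ) ^ 2).im = 0 := by simp [sq, Complex.mul_im]
  rw [hRR, hRI]
  nlinarith [mul_nonneg (sub_nonneg.mpr hz2) (sub_nonneg.mpr hζ2), sq_nonneg (z'.re * ζ'.im - z'.im * ζ'.re),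
    sq_nonneg (z'.re - ζ'.re), sq_nonneg (z'.im - ζ'.im), hR]

/-! ## §3 Finite products over a multiset of zeros (elementary bookkeeping) -/

/-- A multiset product of functions complex differentiable within `S` is complex differentiable within `S`. [folklore] -/
theorem differentiableOn_multiset_map_prod {S : Set ℂ} (f : ℂ → ℂ → ℂ) (s : Multiset ℂ)
    (hf : ∀ ζ ∈ s, DifferentiableOn ℂ (f ζ) S) :
    DifferentiableOn ℂ (fun z => (s.map fun ζ => f ζ z).prod) S := by
  induction s using Multiset.induction_on with
  | empty => simp
  | cons a s ih =>
    simp only [Multiset.map_cons, Multiset.prod_cons]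
    exact (hf a (Multiset.mem_cons_self a s)).mul (ih fun ζ hζ => hf ζ (Multiset.mem_cons_of_mem hζ))

/-- A multiset product of complex numbers of norm `≤ 1` has norm `≤ 1`. [folklore] -/
theorem norm_multiset_map_prod_le_one (f : ℂ → ℂ) (s : Multiset ℂ) (hf : ∀ ζ ∈ s, ‖f ζ‖ ≤ 1) :
    ‖(s.map f).prod‖ ≤ 1 := by
  induction s using Multiset.induction_on with
  | empty => simp
  | cons a s ih =>
    rw [Multiset.map_cons, Multiset.prod_cons, norm_mul]
    have ha : ‖f a‖ ≤ 1 := hf a (Multiset.mem_cons_self a s)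
    have hs : ‖(s.map f).prod‖ ≤ 1 := ih fun ζ hζ => hf ζ (Multiset.mem_cons_of_mem hζ)
    calc ‖f a‖ * ‖(Multiset.map f s).prod‖ ≤ 1 * 1 :=
          mul_le_mul ha hs (norm_nonneg _) zero_le_one
      _ = 1 := one_mul 1

/-- A multiset product of non-zero complex numbers is non-zero. [folklore] -/
theorem multiset_map_prod_ne_zero (f : ℂ → ℂ) (s : Multiset ℂ) (hf : ∀ ζ ∈ s, f ζ ≠ 0) :
    (s.map f).prod ≠ 0 := by
  induction s using Multiset.induction_on with
  | empty => simp
  | cons a s ih =>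
    rw [Multiset.map_cons, Multiset.prod_cons]
    exact mul_ne_zero (hf a (Multiset.mem_cons_self a s)) (ih fun ζ hζ => hf ζ (Multiset.mem_cons_of_mem hζ))

/-- The Green-budget identity at the target: `exp(Σ_{ζ∈s} log(R/‖ζ − zT‖)) · ‖∏_{ζ∈s} (zT − ζ)‖ = R^{|s|}` when no `ζ ∈ s`
equals `zT` and `0 < R`. [folklore] -/
theorem exp_greenBudget_mul_norm_zeroProd (s : Multiset ℂ) (zT : ℂ) {R : ℝ} (hR : 0 < R) (hs : ∀ ζ ∈ s, ζ ≠ zT) :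
    Real.exp ((s.map fun ζ => Real.log (R / ‖ζ - zT‖)).sum) * ‖(s.map fun ζ => zT - ζ).prod‖ = R ^ (Multiset.card s) := by
  induction s using Multiset.induction_on with
  | empty => simp
  | cons a s ih =>
    have ha : a ≠ zT := hs a (Multiset.mem_cons_self a s)
    have hs' : ∀ ζ ∈ s, ζ ≠ zT := fun ζ hζ => hs ζ (Multiset.mem_cons_of_mem hζ)
    have hna : 0 < ‖a - zT‖ := norm_pos_iff.mpr (sub_ne_zero.mpr ha)
    have hsym : ‖zT - a‖ = ‖a - zT‖ := norm_sub_rev zT a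
    rw [Multiset.map_cons, Multiset.sum_cons, Multiset.map_cons, Multiset.prod_cons, Real.exp_add,
      Real.exp_log (div_pos hR hna), norm_mul, Multiset.card_cons, pow_succ, hsym]
    calc R / ‖a - zT‖ * Real.exp (Multiset.map (fun ζ => Real.log (R / ‖ζ - zT‖)) s).sum *
          (‖a - zT‖ * ‖(Multiset.map (fun ζ => zT - ζ) s).prod‖)
        = (R / ‖a - zT‖ * ‖a - zT‖) * (Real.exp (Multiset.map (fun ζ => Real.log (R / ‖ζ - zT‖)) s).sum *
            ‖(Multiset.map (fun ζ => zT - ζ) s).prod‖) := by ring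
      _ = R * R ^ (Multiset.card s) := by rw [div_mul_cancel₀ R hna.ne', ih hs']
      _ = R ^ (Multiset.card s) * R := mul_comm _ _

/-! ## §4 P from T — Blaschke factors and the maximum modulus principle -/

/-- **P from T.**  `TwoConstants → PoissonJensen`, both VERBATIM (bodies unfolded).  Proof: Blaschke quotient
`Φ := (F / g) · ∏_{ζ∈s} R / (R² − conj(ζ − zT)(· − zT))`, maximum modulus on `D` and on `ball z₀ δ₀`
(`Complex.norm_le_of_forall_mem_frontier_norm_le`), T at `zT`, and the target identities of §3. [folklore] -/
theorem poissonJensen_of_twoConstants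
    (hT : ∀ (D : Set ℂ), IsOpen D → IsConnected D →
      ∀ (z₀ : ℂ) (δ₀ : ℝ), 0 < δ₀ → Metric.closedBall z₀ δ₀ ⊆ D → ∀ zT : ℂ, zT ∈ D →
        ∃ ω : ℝ, 0 < ω ∧ ω ≤ 1 ∧
          ∀ F : ℂ → ℂ, DifferentiableOn ℂ F D →
            ∀ a A : ℝ, 0 < a → a ≤ A →
              (∀ z ∈ D, ‖F z‖ ≤ A) → (∀ z ∈ Metric.closedBall z₀ δ₀, ‖F z‖ ≤ a) →
                ‖F zT‖ ≤ a ^ ω * A ^ (1 - ω)) :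
    ∀ (U D : Set ℂ) (z₀ zT : ℂ) (δ₀ R : ℝ),
      IsOpen U → IsOpen D → Bornology.IsBounded D → IsConnected D → closure D ⊆ U →
      0 < δ₀ → Metric.closedBall z₀ δ₀ ⊆ D → IsConnected (D \ Metric.closedBall z₀ δ₀) →
      zT ∈ D → δ₀ < ‖zT - z₀‖ → D ⊆ Metric.ball zT R →
        ∃ ω : ℝ, 0 < ω ∧ ω ≤ 1 ∧
          ∀ (F g : ℂ → ℂ) (s : Multiset ℂ) (a A : ℝ),
            DifferentiableOn ℂ F U → DifferentiableOn ℂ g U → (∀ z ∈ closure D, g z ≠ 0) →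
            (∀ ζ ∈ s, ζ ∈ D ∧ δ₀ < ‖ζ - z₀‖ ∧ ζ ≠ zT) →
            0 < a → a ≤ A →
            (∀ z ∈ frontier D, ‖F z‖ ≤ A * ‖g z * (s.map fun ζ => z - ζ).prod‖) →
            (∀ z ∈ Metric.sphere z₀ δ₀, ‖F z‖ ≤ a * ‖g z * (s.map fun ζ => z - ζ).prod‖) →
              ‖F zT‖ ≤ a ^ ω * A ^ (1 - ω) * Real.exp ((s.map fun ζ => Real.log (R / ‖ζ - zT‖)).sum) *
                ‖g zT * (s.map fun ζ => zT - ζ).prod‖ := by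
  intro U D z₀ zT δ₀ R _hU hD hDb hDc hDU hδ₀ hdisc _hΩ hzT _hzT hDR
  obtain ⟨ω, hω0, hω1, hω⟩ := hT D hD hDc z₀ δ₀ hδ₀ hdisc zT hzT
  refine ⟨ω, hω0, hω1, ?_⟩
  intro F g s a A hF hg hg0 hs ha haA hfr hsph
  -- geometry: `0 < R`, `closure D ⊆ closedBall zT R`, the zeros lie in `ball zT R`
  have hR : 0 < R := by
    have h := hDR hzT
    rw [Metric.mem_ball, dist_self] at h
    exact h
  have hclR : closure D ⊆ Metric.closedBall zT R :=
    (closure_mono hDR).trans Metric.closure_ball_subset_closedBall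
  have hclR' : ∀ z ∈ closure D, ‖z - zT‖ ≤ R := fun z hz => mem_closedBall_iff_norm.1 (hclR hz)
  have hζR : ∀ ζ ∈ s, ‖ζ - zT‖ < R := fun ζ hζ => mem_ball_iff_norm.1 (hDR (hs ζ hζ).1)
  -- the Blaschke quotient
  set den : ℂ → ℂ → ℂ := fun ζ z => (R : ℂ) ^ 2 - (starRingEnd ℂ) (ζ - zT) * (z - zT) with hden
  have hden_ne : ∀ ζ ∈ s, ∀ z ∈ closure D, den ζ z ≠ 0 := fun ζ hζ z hz =>
    blaschkeDen_ne_zero zT hR (hζR ζ hζ) (hclR' z hz)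
  set Φ : ℂ → ℂ := fun z => F z / g z * (s.map fun ζ => (R : ℂ) / den ζ z).prod with hΦ
  -- `Φ` is complex differentiable within `closure D`
  have hΦd : DifferentiableOn ℂ Φ (closure D) := by
    have hF' : DifferentiableOn ℂ F (closure D) := hF.mono hDU
    have hg' : DifferentiableOn ℂ g (closure D) := hg.mono hDU
    refine (hF'.div hg' hg0).mul (differentiableOn_multiset_map_prod (fun ζ z => (R : ℂ) / den ζ z) s ?_)
    intro ζ hζ
    refine (differentiableOn_const _).div ?_ (hden_ne ζ hζ)
    simp only [hden]
    fun_prop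
  have hΦD : DiffContOnCl ℂ Φ D := hΦd.diffContOnCl
  have hΦB : DiffContOnCl ℂ Φ (Metric.ball z₀ δ₀) :=
    hΦd.diffContOnCl_ball (hdisc.trans subset_closure)
  -- the key pointwise identity `Φ z * G z = F z * ∏ b_ζ z` where `g z ≠ 0`
  have hkey : ∀ z, g z ≠ 0 →
      Φ z * (g z * (s.map fun ζ => z - ζ).prod) =
        F z * (s.map fun ζ => (R : ℂ) * (z - ζ) / den ζ z).prod := by
    intro z hgz
    have h1 : (s.map fun ζ => (R : ℂ) * (z - ζ) / den ζ z).prod =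
        (s.map fun ζ => (R : ℂ) / den ζ z).prod * (s.map fun ζ => z - ζ).prod := by
      rw [← Multiset.prod_map_mul]
      congr 1
      refine Multiset.map_congr rfl fun ζ _ => ?_
      ring
    rw [h1, hΦ]
    field_simp
  -- hence `‖Φ z‖ · ‖G z‖ ≤ ‖F z‖` on `closure D`
  have hΦle : ∀ z ∈ closure D, ‖Φ z‖ * ‖g z * (s.map fun ζ => z - ζ).prod‖ ≤ ‖F z‖ := by
    intro z hz
    rw [← norm_mul, hkey z (hg0 z hz), norm_mul]
    have hb : ‖(s.map fun ζ => (R : ℂ) * (z - ζ) / den ζ z).prod‖ ≤ 1 :=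
      norm_multiset_map_prod_le_one _ s fun ζ hζ => norm_blaschkeFactor_le_one zT hR (hζR ζ hζ) (hclR' z hz)
    calc ‖F z‖ * ‖(s.map fun ζ => (R : ℂ) * (z - ζ) / den ζ z).prod‖ ≤ ‖F z‖ * 1 :=
          mul_le_mul_of_nonneg_left hb (norm_nonneg _)
      _ = ‖F z‖ := mul_one _
  -- `G ≠ 0` off the zeros, inside `closure D`
  have hGne : ∀ z ∈ closure D, (∀ ζ ∈ s, z ≠ ζ) → g z * (s.map fun ζ => z - ζ).prod ≠ 0 := fun z hz hzs =>
    mul_ne_zero (hg0 z hz) (multiset_map_prod_ne_zero _ s fun ζ hζ => sub_ne_zero.mpr (hzs ζ hζ))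
  -- `‖Φ‖ ≤ A` on the frontier of `D`, hence on `closure D`
  have hΦfr : ∀ z ∈ frontier D, ‖Φ z‖ ≤ A := by
    intro z hz
    have hzcl : z ∈ closure D := frontier_subset_closure hz
    have hzs : ∀ ζ ∈ s, z ≠ ζ := by
      intro ζ hζ hzζ
      have hζfr : ζ ∈ D ∩ frontier D := ⟨(hs ζ hζ).1, hzζ ▸ hz⟩
      rw [hD.inter_frontier_eq] at hζfr
      exact hζfr
    have hGpos : 0 < ‖g z * (s.map fun ζ => z - ζ).prod‖ := norm_pos_iff.mpr (hGne z hzcl hzs)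
    exact le_of_mul_le_mul_right ((hΦle z hzcl).trans (hfr z hz)) hGpos
  have hΦA : ∀ z ∈ D, ‖Φ z‖ ≤ A := fun z hz =>
    Complex.norm_le_of_forall_mem_frontier_norm_le hDb hΦD hΦfr (subset_closure hz)
  -- `‖Φ‖ ≤ a` on the anchor circle, hence on the closed anchor disc
  have hΦsph : ∀ z ∈ frontier (Metric.ball z₀ δ₀), ‖Φ z‖ ≤ a := by
    intro z hz
    rw [frontier_ball z₀ hδ₀.ne'] at hz
    have hzcl : z ∈ closure D := subset_closure (hdisc (Metric.sphere_subset_closedBall hz))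
    have hzs : ∀ ζ ∈ s, z ≠ ζ := by
      intro ζ hζ hzζ
      have h1 : ‖z - z₀‖ = δ₀ := mem_sphere_iff_norm.1 hz
      have h2 : δ₀ < ‖ζ - z₀‖ := (hs ζ hζ).2.1
      rw [← hzζ, h1] at h2
      exact lt_irrefl _ h2
    have hGpos : 0 < ‖g z * (s.map fun ζ => z - ζ).prod‖ := norm_pos_iff.mpr (hGne z hzcl hzs)
    exact le_of_mul_le_mul_right ((hΦle z hzcl).trans (hsph z hz)) hGpos
  have hΦa : ∀ z ∈ Metric.closedBall z₀ δ₀, ‖Φ z‖ ≤ a := by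
    intro z hz
    refine Complex.norm_le_of_forall_mem_frontier_norm_le Metric.isBounded_ball hΦB hΦsph ?_
    rw [closure_ball z₀ hδ₀.ne']
    exact hz
  -- T at the target
  have hT' : ‖Φ zT‖ ≤ a ^ ω * A ^ (1 - ω) := hω Φ (hΦd.mono subset_closure) a A ha haA hΦA hΦa
  -- unpack `Φ zT`
  have hΦzT : Φ zT = F zT / g zT * ((R : ℂ)⁻¹) ^ (Multiset.card s) := by
    simp only [hΦ, hden, sub_self, mul_zero, sub_zero]
    rw [Multiset.map_const', Multiset.prod_replicate]
    have hRc : (R : ℂ) ≠ 0 := by exact_mod_cast hR.ne'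
    congr 2
    rw [pow_two, ← div_div, div_self hRc, one_div]
  have hgzT : g zT ≠ 0 := hg0 zT (subset_closure hzT)
  have hgpos : 0 < ‖g zT‖ := norm_pos_iff.mpr hgzT
  have hFzT : ‖F zT‖ = ‖Φ zT‖ * ‖g zT‖ * R ^ (Multiset.card s) := by
    rw [hΦzT, norm_mul, norm_div, norm_pow, norm_inv, Complex.norm_real, Real.norm_eq_abs, abs_of_pos hR,
      div_mul_eq_mul_div, div_mul_cancel₀ _ hgpos.ne', mul_assoc, ← mul_pow, inv_mul_cancel₀ hR.ne', one_pow, mul_one]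
  have hbudget : Real.exp ((s.map fun ζ => Real.log (R / ‖ζ - zT‖)).sum) * ‖g zT * (s.map fun ζ => zT - ζ).prod‖ =
      ‖g zT‖ * R ^ (Multiset.card s) := by
    rw [norm_mul, mul_left_comm, exp_greenBudget_mul_norm_zeroProd s zT hR fun ζ hζ => (hs ζ hζ).2.2]
  calc ‖F zT‖ = ‖Φ zT‖ * (‖g zT‖ * R ^ (Multiset.card s)) := by rw [hFzT, mul_assoc]
    _ ≤ a ^ ω * A ^ (1 - ω) * (‖g zT‖ * R ^ (Multiset.card s)) :=
        mul_le_mul_of_nonneg_right hT' (mul_nonneg (norm_nonneg _) (pow_nonneg hR.le _))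
    _ = a ^ ω * A ^ (1 - ω) * Real.exp ((s.map fun ζ => Real.log (R / ‖ζ - zT‖)).sum) *
          ‖g zT * (s.map fun ζ => zT - ζ).prod‖ := by rw [mul_assoc (a ^ ω * A ^ (1 - ω)), hbudget]

/-! ## §5 P -/

/-- **P (`PoissonJensen`, verbatim).**  Geometry: `closure D ⊆ U` open, `D` open bounded connected, a closed disc
`closedBall z₀ δ₀ ⊆ D`, a target `zT ∈ D` off the disc, `D ⊆ ball zT R`.  Then there is `ω ∈ (0,1]` such that for all `F, g`
holomorphic on `U`, `g` zero-free on `closure D`, every finite multiset `s` of zeros in `D` off the closed disc and off `zT`, and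
`G := g · ∏_{ζ∈s}(· − ζ)`: if `‖F‖ ≤ A‖G‖` on `frontier D` and `‖F‖ ≤ a‖G‖` on `sphere z₀ δ₀` (`0 < a ≤ A`), then
`‖F(zT)‖ ≤ a^ω · A^{1−ω} · exp(Σ_{ζ∈s} log(R/‖ζ − zT‖)) · ‖G(zT)‖`.  From T (`twoConstants_holds`) by
`poissonJensen_of_twoConstants`. -/
theorem poissonJensen_holds :
    ∀ (U D : Set ℂ) (z₀ zT : ℂ) (δ₀ R : ℝ),
      IsOpen U → IsOpen D → Bornology.IsBounded D → IsConnected D → closure D ⊆ U →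
      0 < δ₀ → Metric.closedBall z₀ δ₀ ⊆ D → IsConnected (D \ Metric.closedBall z₀ δ₀) →
      zT ∈ D → δ₀ < ‖zT - z₀‖ → D ⊆ Metric.ball zT R →
        ∃ ω : ℝ, 0 < ω ∧ ω ≤ 1 ∧
          ∀ (F g : ℂ → ℂ) (s : Multiset ℂ) (a A : ℝ),
            DifferentiableOn ℂ F U → DifferentiableOn ℂ g U → (∀ z ∈ closure D, g z ≠ 0) →
            (∀ ζ ∈ s, ζ ∈ D ∧ δ₀ < ‖ζ - z₀‖ ∧ ζ ≠ zT) →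
            0 < a → a ≤ A →
            (∀ z ∈ frontier D, ‖F z‖ ≤ A * ‖g z * (s.map fun ζ => z - ζ).prod‖) →
            (∀ z ∈ Metric.sphere z₀ δ₀, ‖F z‖ ≤ a * ‖g z * (s.map fun ζ => z - ζ).prod‖) →
              ‖F zT‖ ≤ a ^ ω * A ^ (1 - ω) * Real.exp ((s.map fun ζ => Real.log (R / ‖ζ - zT‖)).sum) *
                ‖g zT * (s.map fun ζ => zT - ζ).prod‖ :=
  poissonJensen_of_twoConstants twoConstants_holds

end Summit.QuantumFields.YangMills.Cruxes.IR.PurityChannelClassical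

end
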